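import Literature.MathematicalPhysics.QuantumLattice.GrassmannWeightedLaplacianTruncatedBoundPrescribed
import Literature.MathematicalPhysics.QuantumLattice.GrassmannWeightedLaplacianPatternOriented
import HarnessLib

/-!
# The decay-weighted `L¹–L^∞` bound for truncated expectations with prescribed output SECTORS and ORIENTED tree lines

Topic `Literature/MathematicalPhysics/QuantumLattice`; the oriented twin of `GrassmannWeightedLaplacianTruncatedBoundPrescribed`
(Benfatto–Giuliani–Mastropietro 2006, (2.66)–(2.80) with §3 and the sectorised bookkeeping of §2.8 / App. A4 (A4.8)).  The only change
is the per-pattern estimate: `sum_kerProd_sum_wt_patWeight_le_oriented` replaces `sum_kerProd_sum_wt_patWeight_le_prescribed`, so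
that every vertex `u` of the anchored tree is estimated by its LEVELLED weighted anchored norm at level
`F_u + swChildren u + [u root ∨ o u]` for a reading `o` of the lines chosen PER TREE AND LANDING PROFILE; the choice is abstracted
into an oracle bound `Nφ φ` (`hNφ`: for the (resp. every covering valid) script and every landing profile `φ` some reading achieves
`∏_u N_u(…) ≤ Nφ φ` — in BGM 2006 the reading of App. A4 realising `Σ_a lumps(F_a) = lumps(F)`, cf.
`FermiRG.BGM2006Routing.exists_orientation_lumps`), and the line constant becomes `c·α` (`c` talking sectors).

* `sum_wt_sum_norm_kernel_treeFactor_le_oriented` — one script;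
* `sum_wt_norm_kernel_ursellOf_kernelVertex_le_oriented` — the bound for `𝓔ᵀ(M_0, …, M_{n-1})`.

Everything is proved; no named fact.  (The private counting lemmas are copies of those of the prescribed file.)

## Sources

G. Benfatto, A. Giuliani, V. Mastropietro, Ann. Henri Poincaré 7 (2006) 809–898, (2.66)–(2.80), §3 (3.2)–(3.8), §2.8, App. A4 (A4.8)
(`BenfattoGiulianiMastropietro2006`).
-/

noncomputable section

namespace Literature.MathematicalPhysics.QuantumLattice

open GrassmannAlgebra Finset MvPolynomial Literature.RingTheory.MvPolynomial
open Literature.Probability.LatticeModels Literature.Probability.LatticeModels.BattleFederbush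
open Literature.MeasureTheory.Integral
open scoped InnerProductSpace

/-! ### Counting admissible patterns with a given landing profile -/

section Patterns

variable {𝕜 : Type*} {Γ : Type*} {N : ℕ}

/-- Admissibility for a list of predicates given slot by slot. [folklore] -/
private theorem stepsOK_ofFn_iff : ∀ {r : ℕ} (P : Fin r → Fin N × Fin N → Bool) (π : List (Fin N × Fin N)),
    stepsOK (List.ofFn P) π = true ↔ ∃ h : r ≤ π.length, ∀ j : Fin r, P j (π[(j : ℕ)]'(lt_of_lt_of_le j.2 h)) = true
  | 0, P, π => by simp [stepsOK]
  | r + 1, P, [] => by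
    rw [List.ofFn_succ, stepsOK]
    simp
  | r + 1, P, pq :: π => by
    rw [List.ofFn_succ, stepsOK, Bool.and_eq_true, stepsOK_ofFn_iff (fun j => P j.succ) π]
    constructor
    · rintro ⟨h0, h, hall⟩
      refine ⟨by rw [List.length_cons]; omega, fun j => ?_⟩
      refine Fin.cases ?_ (fun j' => ?_) j
      · simpa using h0
      · simpa using hall j'
    · rintro ⟨h, hall⟩
      refine ⟨by simpa using hall 0, by rw [List.length_cons] at h; omega, fun j' => ?_⟩
      simpa using hall j'.succ

/-- The count bound of derivative steps with slot-dependent per-step bounds. [folklore] -/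
private theorem countBound_ofFn_ext : ∀ {r : ℕ} (X : Fin r → Γ) (b : Fin r → ℕ → ℕ) (m : ℕ),
    countBound (List.ofFn fun j => ((DelOp.ext (X j) : DelOp Γ 𝕜), b j)) m = ∏ j : Fin r, b j (m - j)
  | 0, X, b, m => by simp [countBound]
  | r + 1, X, b, m => by
    rw [List.ofFn_succ, countBound, countBound_ofFn_ext (fun j => X j.succ) (fun j => b j.succ), Fin.prod_univ_succ]
    congr 1
    refine prod_congr rfl fun j _ => ?_
    simp only [DelOp.cost, Fin.val_succ]
    rw [Nat.sub_sub, Nat.add_comm]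

end Patterns

variable {𝕜 : Type*} [RCLike 𝕜] {Γ : Type*} [Fintype Γ] [DecidableEq Γ] {n : ℕ}
variable (C : Matrix Γ Γ 𝕜) (cl : Γ → Fin n) {deg : Fin n → ℕ} (K : ∀ v : Fin n, (Fin (deg v) → Γ) → 𝕜)
variable {wt : Finset Γ → ℝ}

omit [RCLike 𝕜] [Fintype Γ] [DecidableEq Γ] in
/-- The derivative steps sitting in the vertex `u` number `≤ m_u`. [folklore] -/
private theorem card_filter_stepSet_ext_vert_le (S : Finset (Fin (∑ v, deg v))) (X : Γ) (u : Fin n) :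
    ((DelOp.stepSet S (DelOp.ext X : DelOp Γ 𝕜)).filter fun pq => vert deg pq.1 = u).card ≤ deg u := by
  rw [← card_filter_vert deg u]
  refine card_le_card_of_injOn Prod.fst (fun pq hpq => ?_) fun pq hpq pq' hpq' h => ?_
  · rw [mem_coe, mem_filter] at hpq ⊢
    exact ⟨mem_univ _, hpq.2⟩
  · rw [mem_coe, mem_filter, DelOp.stepSet, mem_filter] at hpq hpq'
    exact Prod.ext h (by rw [hpq.1.2, hpq'.1.2, h])

/-! ### One script with prescribed output slots, weighted: regrouping the patterns by landing profile -/

omit [Fintype Γ] [DecidableEq Γ] in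
/-- **Counting the admissible patterns with a given landing profile on the prescribed slots**: the derivative step of a
prescribed slot `j` sits in the vertex `φ j` (`≤ m_{φ j}` choices), the other derivative steps are free (`≤ N - j` choices),
the Laplacian steps as in `card_filter_lapPred_le`. [folklore] -/
private theorem card_filter_patSet_profile_le (w : Γ) {k : ℕ} (s : Script (cl w) k) {r : ℕ} (J : Finset (Fin r))
    (φ : Fin r → Fin n) :
    ((patSet (scriptOps C cl (fun _ : Fin r => w) s) univ).filter fun π =>
        stepsOK (List.replicate r (fun _ => true) ++ s.lines.reverse.map (lapPred deg)) π = true ∧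
          ∀ j ∈ J, ((π[(j : ℕ)]?).map fun pq => vert deg pq.1) = some (φ j)).card ≤
      ((∏ j ∈ J, deg (φ j)) * ∏ j ∈ univ.filter (fun j : Fin r => j ∉ J), ((∑ v, deg v) - (j : ℕ))) *
        (s.lines.reverse.map fun ℓ => 2 * pairDeg deg ℓ).prod := by
  classical
  set pred : Fin r → (Fin (∑ v, deg v) × Fin (∑ v, deg v) → Bool) := fun j pq => decide (j ∈ J → vert deg pq.1 = φ j)
    with hpred
  set bd : Fin r → ℕ → ℕ := fun j m => if j ∈ J then deg (φ j) else m with hbd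
  set L : List (DelOp Γ 𝕜 × (Fin (∑ v, deg v) × Fin (∑ v, deg v) → Bool) × (ℕ → ℕ)) :=
    (List.ofFn fun j : Fin r => ((DelOp.ext w : DelOp Γ 𝕜), pred j, bd j)) ++
      (s.lines.reverse.map fun ℓ => (DelOp.lap (typeRestrict C cl ℓ), lapPred deg ℓ, fun _ => 2 * pairDeg deg ℓ)) with hL
  have hfst : L.map Prod.fst = scriptOps C cl (fun _ : Fin r => w) s := by
    rw [hL, List.map_append, List.map_ofFn, List.map_map, scriptOps, List.map_ofFn]; rfl
  have hsnd : L.map (fun x => x.2.1) = List.ofFn pred ++ s.lines.reverse.map (lapPred deg) := by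
    rw [hL, List.map_append, List.map_ofFn, List.map_map]; rfl
  have hthd : L.map (fun x => (x.1, x.2.2)) = (List.ofFn fun j : Fin r => ((DelOp.ext w : DelOp Γ 𝕜), bd j)) ++
      s.lines.reverse.map (fun ℓ => ((DelOp.lap (typeRestrict C cl ℓ) : DelOp Γ 𝕜), fun _ : ℕ => 2 * pairDeg deg ℓ)) := by
    rw [hL, List.map_append, List.map_ofFn, List.map_map]; rfl
  have hB : ∀ x ∈ L, ∀ S' : Finset (Fin (∑ v, deg v)),
      ((DelOp.stepSet S' x.1).filter fun pq => x.2.1 pq).card ≤ x.2.2 S'.card := by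
    intro x hx S'
    rw [hL, List.mem_append, List.mem_ofFn, List.mem_map] at hx
    rcases hx with ⟨j, rfl⟩ | ⟨ℓ, -, rfl⟩
    · dsimp only
      by_cases hj : j ∈ J
      · rw [hbd]
        dsimp only
        rw [if_pos hj]
        refine le_trans (card_le_card fun pq h => ?_) (card_filter_stepSet_ext_vert_le (𝕜 := 𝕜) S' w (φ j))
        rw [mem_filter] at h ⊢
        refine ⟨h.1, ?_⟩
        have h2 := h.2
        rw [hpred] at h2
        dsimp only at h2
        rw [decide_eq_true_iff] at h2
        exact h2 hj
      · rw [hbd]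
        dsimp only
        rw [if_neg hj]
        exact (card_filter_le _ _).trans (le_of_eq (DelOp.card_stepSet_ext S' w))
    · exact card_filter_lapPred_le S' _ ℓ
  have h := card_filter_patSet_le L hB univ
  rw [hfst, hsnd, hthd, card_univ, Fintype.card_fin, countBound_append, countBound_ofFn_ext,
    countBound_consts (fun ℓ => (DelOp.lap (typeRestrict C cl ℓ) : DelOp Γ 𝕜)) (fun ℓ => 2 * pairDeg deg ℓ)] at h
  have hbdprod : ∏ j : Fin r, bd j ((∑ v, deg v) - (j : ℕ)) =
      (∏ j ∈ J, deg (φ j)) * ∏ j ∈ univ.filter (fun j : Fin r => j ∉ J), ((∑ v, deg v) - (j : ℕ)) := by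
    rw [hbd]
    dsimp only
    rw [prod_ite, filter_mem_eq_inter, univ_inter]
  rw [hbdprod] at h
  refine le_trans (card_le_card fun π hπ => ?_) h
  rw [mem_filter] at hπ ⊢
  refine ⟨hπ.1, ?_⟩
  obtain ⟨hadm, hJ⟩ := hπ.2
  rw [stepsOK_append, List.length_replicate, stepsOK_replicate_true, Bool.and_eq_true, decide_eq_true_iff,
    List.length_take] at hadm
  have hr : r ≤ π.length := by
    rcases le_total r π.length with h' | h'
    · exact h'
    · rw [min_eq_right h'] at hadm; exact hadm.1
  rw [stepsOK_append, List.length_ofFn, Bool.and_eq_true]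
  refine ⟨(stepsOK_ofFn_iff pred (π.take r)).2 ⟨by rw [List.length_take, min_eq_left hr], fun j => ?_⟩, hadm.2⟩
  rw [hpred]
  dsimp only
  rw [decide_eq_true_iff]
  intro hj
  have h1 := hJ j hj
  rw [List.getElem?_eq_getElem (lt_of_lt_of_le j.2 hr), Option.map_some, Option.some.injEq] at h1
  rw [List.getElem_take]
  exact h1

/-- The prescribed-slot profile count read through the subtype `J`: cardinalities of the fibres. [folklore] -/
private theorem card_filter_subtype_eq {r : ℕ} (J : Finset (Fin r)) (p : Fin r → Prop) [DecidablePred p] :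
    (univ.filter fun j : J => p (j : Fin r)).card = (J.filter p).card := by
  rw [univ_eq_attach, filter_attach, card_map, card_attach]

variable {Sec : Type*} [Fintype Sec] [DecidableEq Sec]

/-- **One script with prescribed output sectors and oriented lines, weighted** (Benfatto–Giuliani–Mastropietro 2006, (2.77) with §3 for
one anchored tree, and the sectorised bookkeeping of §2.8 / App. A4 (A4.8)): the weighted label sum regrouped by the landing profile
`φ : J → vertices` of the prescribed slots; for every profile some reading `o` of the lines achieves
`∏_u N_u(|φ⁻¹ u| + swChildren u + [u root ∨ o u]) ≤ Nφ φ` (`hNφ`), whence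
`Σ_{W : W_i = w, A_j(W_j)} wt(W) Σ_Y ∏‖K‖ ‖kernel_r (treeFactor s ψ(flat Y)) (W)‖ ≤
(r!)⁻¹ (∏_{j∉J}(N-j)) κ^{N-r-2k} (Σ_φ (∏_{j∈J} m_{φ j}) Nφ φ) (∏_{ℓ ∈ lines} c α m m'_ℓ) ∫ w_s`.
[cite: BenfattoGiulianiMastropietro2006, (2.77), §3 (3.2)-(3.8), §2.8 (2.97)-(2.98), App. A4 (A4.8)] -/
theorem sum_wt_sum_norm_kernel_treeFactor_le_oriented (hwt : IsTreeWeight wt) {κ : ℝ} (hκ : 0 ≤ κ) (hGB : IsGramBounded C κ)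
    (hK : ∀ v Yv, K v Yv ≠ 0 → ∀ j, cl (Yv j) = v)
    (sec : Γ → Sec) (ov : Sec → Sec → Prop) [DecidableRel ov] {c : ℕ} (hc1 : 1 ≤ c)
    (hov : ∀ σ' : Sec, (univ.filter fun σ : Sec => ov σ σ').card ≤ c)
    (hCov : ∀ ℓ X Y, typeRestrict C cl ℓ X Y ≠ 0 → ov (sec X) (sec Y) ∧ ov (sec Y) (sec X))
    {r : ℕ} (J : Finset (Fin r)) (A : Fin r → Γ → Bool) (σp : Fin r → Sec) (hA : ∀ j ∈ J, ∀ y, A j y = true → sec y = σp j)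
    (Nv : Fin n → ℕ → ℝ) (hN0 : ∀ u F, 0 ≤ Nv u F)
    (hN : ∀ (ρ' : Fin (∑ v, deg v) → Option Sec) (u : Fin n) (j : Fin (deg u)), ρ' (blockEmb deg u j) = none → ∀ a : Γ,
      ∑ Y ∈ univ.filter (fun Y : Fin (deg u) → Γ => Y j = a),
        (if ∀ j' σ, ρ' (blockEmb deg u j') = some σ → sec (Y j') = σ then ‖K u Y‖ * wt (univ.image Y) else 0) ≤
        Nv u (levR (vert deg) ρ' u + 1))
    (hNsw : ∀ (ρ' : Fin (∑ v, deg v) → Option Sec) (u : Fin n) (j : Fin (deg u)), ρ' (blockEmb deg u j) = none →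
      ∃ g : Sec → ℝ, (∀ σ, 0 ≤ g σ) ∧
      (∀ a : Γ, ∑ Y ∈ univ.filter (fun Y : Fin (deg u) → Γ => Y j = a),
        (if ∀ j' σ, ρ' (blockEmb deg u j') = some σ → sec (Y j') = σ then ‖K u Y‖ * wt (univ.image Y) else 0) ≤
          g (sec a)) ∧
      ∑ σ, g σ ≤ Nv u (levR (vert deg) ρ' u))
    (Nφ : (J → Fin n) → ℝ) (hNφ0 : ∀ φ, 0 ≤ Nφ φ)
    {α : ℝ} (hα : 0 ≤ α) (hrow : ∀ ℓ X, ∑ Y, ‖typeRestrict C cl ℓ X Y‖ * wt {X, Y} ≤ α)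
    (hcol : ∀ ℓ Y, ∑ X, ‖typeRestrict C cl ℓ X Y‖ * wt {X, Y} ≤ α)
    {w : Γ} {k : ℕ} (s : Script (cl w) k) (hs : s.Valid) (hcov : univ.image s.y = univ)
    (hNφ : ∀ φ : J → Fin n, ∃ o : Fin n → Bool,
      ∏ u, Nv u ((univ.filter fun j : J => φ j = u).card + swChildren s o u + if u = cl w ∨ o u = true then 1 else 0) ≤ Nφ φ)
    (i : Fin r) (hi : i ∉ J) :
    ∑ W ∈ univ.filter (fun W : Fin r → Γ => W i = w ∧ ∀ j ∈ J, A j (W j) = true), wt (univ.image W) *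
        ∑ Ys : (∀ v, Fin (deg v) → Γ), (∏ u, ‖K u (Ys u)‖) *
        ‖kernel 𝕜 (((Script.treeFactor (pairLap 𝕜 C cl) s : laplacianAlgebra 𝕜 C cl) : Module.End 𝕜 (GrassmannAlgebra 𝕜 Γ))
          (genProd 𝕜 (flat Ys))) r W‖ ≤
      ((((r.factorial : ℝ))⁻¹ * ((∏ j ∈ univ.filter (fun j : Fin r => j ∉ J), ((∑ v, deg v) - (j : ℕ)) : ℕ) : ℝ)) *
          κ ^ ((∑ v, deg v) - (r + 2 * k)) *
          ∑ φ : J → Fin n, (∏ j, (deg (φ j) : ℝ)) * Nφ φ) *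
        ((s.lines.map fun ℓ => (c * α) * (pairDeg deg ℓ : ℝ)).prod * cubeIntegral (Fin n) ℝ (s.weight ℝ)) := by
  classical
  set P := patSet (scriptOps C cl (fun _ : Fin r => w) s) (univ : Finset (Fin (∑ v, deg v))) with hP
  set Iw := cubeIntegral (Fin n) ℝ (s.weight ℝ) with hIw
  set c₀ := ((r.factorial : ℝ))⁻¹ with hc
  set e := (∑ v, deg v) - (r + 2 * k) with he
  set ext : ℕ := ∏ j ∈ univ.filter (fun j : Fin r => j ∉ J), ((∑ v, deg v) - (j : ℕ)) with hext
  set Wset := univ.filter (fun W : Fin r → Γ => W i = w ∧ ∀ j ∈ J, A j (W j) = true) with hWset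
  set preds := List.replicate r (fun _ : Fin (∑ v, deg v) × Fin (∑ v, deg v) => true) ++ s.lines.reverse.map (lapPred deg)
    with hpreds
  set prof : List (Fin (∑ v, deg v) × Fin (∑ v, deg v)) → Fin n → ℕ := fun π u =>
    (J.filter fun j : Fin r => ((π[(j : ℕ)]?).map fun pq => vert deg pq.1) = some u).card with hprof
  set M : (J → Fin n) → ℝ := fun φ => ∏ j, (deg (φ j) : ℝ) with hM
  have hIw0 : 0 ≤ Iw := cubeIntegral_nonneg _ fun t ht => FermionicTree.eval_weight_nonneg s ht
  have hc0 : 0 ≤ c₀ := inv_nonneg.2 (Nat.cast_nonneg _)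
  have hcα : 0 ≤ (c : ℝ) * α := mul_nonneg (Nat.cast_nonneg _) hα
  have hM0 : ∀ φ, 0 ≤ M φ := fun φ => prod_nonneg fun j _ => Nat.cast_nonneg _
  have hG0 : ∀ Ys : ∀ v, Fin (deg v) → Γ, 0 ≤ ∏ u, ‖K u (Ys u)‖ := fun Ys => prod_nonneg fun u _ => norm_nonneg _
  -- the Gram bound per output slot and label family
  have h1 : ∀ (W : Fin r → Γ) (Ys : ∀ v, Fin (deg v) → Γ), wt (univ.image W) * ((∏ u, ‖K u (Ys u)‖) *
      ‖kernel 𝕜 (((Script.treeFactor (pairLap 𝕜 C cl) s : laplacianAlgebra 𝕜 C cl) : Module.End 𝕜 (GrassmannAlgebra 𝕜 Γ))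
        (genProd 𝕜 (flat Ys))) r W‖) ≤
      ∑ π ∈ P, (c₀ * κ ^ e * Iw) * ((∏ u, ‖K u (Ys u)‖) * (wt (univ.image W) * patWeight (flat Ys) (scriptOps C cl W s) π)) := by
    intro W Ys
    have h := norm_kernel_treeFactor_genProd_le_of_gramBounded C cl hκ hGB s hs (flat Ys) W
    rw [patSet_scriptOps_eq C cl W (fun _ => w) s, ← hP, ← hc, ← he, ← hIw] at h
    refine (mul_le_mul_of_nonneg_left (mul_le_mul_of_nonneg_left h (hG0 Ys)) (hwt.nonneg _)).trans (le_of_eq ?_)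
    rw [mul_sum, sum_mul, mul_sum, mul_sum]
    exact sum_congr rfl fun π _ => by ring
  -- the per-line factors
  have hprod : (s.lines.map fun ℓ => (c * α) * (pairDeg deg ℓ : ℝ)).prod =
      (c * (α / 2)) ^ k * (((s.lines.reverse.map fun ℓ => 2 * pairDeg deg ℓ).prod : ℕ) : ℝ) := by
    rw [Nat.cast_list_prod, List.map_map, List.map_reverse, List.prod_reverse,
      show (fun ℓ => (c * α) * (pairDeg deg ℓ : ℝ)) = fun ℓ => (c * (α / 2)) * ((Nat.cast : ℕ → ℝ) ∘ fun ℓ => 2 * pairDeg deg ℓ) ℓ from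
        funext fun ℓ => by simp only [Function.comp_apply, Nat.cast_mul, Nat.cast_ofNat]; ring,
      List.prod_map_mul, List.map_const', List.prod_replicate, Script.length_lines]
  -- regrouping the admissible patterns by landing profile
  set profOf : List (Fin (∑ v, deg v) × Fin (∑ v, deg v)) → (J → Fin n) := fun π j =>
    (((π[((j : Fin r) : ℕ)]?).map fun pq => vert deg pq.1).getD (cl w)) with hprofOf
  have hlen : ∀ π ∈ P.filter (fun π => stepsOK preds π = true), r ≤ π.length := by
    intro π hπ
    have hadm := (mem_filter.1 hπ).2
    rw [hpreds, stepsOK_append, List.length_replicate, stepsOK_replicate_true, Bool.and_eq_true, decide_eq_true_iff,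
      List.length_take] at hadm
    rcases le_total r π.length with h' | h'
    · exact h'
    · rw [min_eq_right h'] at hadm; exact hadm.1
  have hsome : ∀ π ∈ P.filter (fun π => stepsOK preds π = true), ∀ j : J,
      ((π[((j : Fin r) : ℕ)]?).map fun pq => vert deg pq.1) = some (profOf π j) := by
    intro π hπ j
    rw [hprofOf]
    dsimp only
    rw [List.getElem?_eq_getElem (lt_of_lt_of_le (j : Fin r).2 (hlen π hπ)), Option.map_some, Option.getD_some]
  have hfib : ∀ π ∈ P.filter (fun π => stepsOK preds π = true), ∀ u, prof π u = (univ.filter fun j : J => profOf π j = u).card := by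
    intro π hπ u
    rw [hprof]
    dsimp only
    rw [← card_filter_subtype_eq J]
    refine congrArg card (filter_congr fun j _ => ?_)
    rw [hsome π hπ j, Option.some.injEq]
  -- the per-pattern estimate, with the reading chosen for the landing profile of the pattern
  have hpat : ∀ π ∈ P, ∑ Ys : (∀ v, Fin (deg v) → Γ), (∏ u, ‖K u (Ys u)‖) *
        ∑ W ∈ Wset, wt (univ.image W) * patWeight (flat Ys) (scriptOps C cl W s) π ≤
      (if stepsOK preds π then 1 else 0) * ((c * (α / 2)) ^ k * Nφ (profOf π)) := by
    intro π hπ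
    obtain ⟨o, ho⟩ := hNφ (profOf π)
    refine (sum_kerProd_sum_wt_patWeight_le_oriented C cl K hwt hK sec ov hc1 hov hCov J A σp hA Nv hN0 hN hNsw hα hrow hcol
      s hs hcov o i hi hπ).trans ?_
    by_cases hok : stepsOK preds π = true
    · rw [← hpreds, if_pos hok, one_mul, one_mul]
      refine mul_le_mul_of_nonneg_left (le_trans (le_of_eq (prod_congr rfl fun u _ => ?_)) ho) (pow_nonneg (by positivity) _)
      have hf := hfib π (mem_filter.2 ⟨hπ, hok⟩) u
      simp only [hprof] at hf
      rw [hf]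
    · rw [← hpreds, if_neg hok, zero_mul, zero_mul]
  -- the count of one fibre
  have hcount : ∀ φ : J → Fin n,
      ((((P.filter fun π => stepsOK preds π = true).filter fun π => profOf π = φ).card : ℕ) : ℝ) ≤
        M φ * (ext : ℝ) * (((s.lines.reverse.map fun ℓ => 2 * pairDeg deg ℓ).prod : ℕ) : ℝ) := by
    intro φ
    set φ' : Fin r → Fin n := fun j => if h : j ∈ J then φ ⟨j, h⟩ else cl w with hφ'
    have hM' : M φ = (((∏ j ∈ J, deg (φ' j)) : ℕ) : ℝ) := by
      rw [hM, Nat.cast_prod, ← prod_coe_sort J]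
      refine prod_congr rfl fun j _ => ?_
      rw [hφ']
      dsimp only
      rw [dif_pos j.2]
    have h := card_filter_patSet_profile_le C cl (deg := deg) w s J φ'
    rw [← hP, ← hpreds, ← hext] at h
    rw [hM', ← Nat.cast_mul, ← Nat.cast_mul, Nat.cast_le]
    refine le_trans (card_le_card fun π hπ => ?_) h
    rw [filter_filter, mem_filter] at hπ
    rw [mem_filter]
    refine ⟨hπ.1, hπ.2.1, fun j hj => ?_⟩
    have hπ' : π ∈ P.filter (fun π => stepsOK preds π = true) := mem_filter.2 ⟨hπ.1, hπ.2.1⟩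
    rw [hsome π hπ' ⟨j, hj⟩, hπ.2.2, hφ']
    dsimp only
    rw [dif_pos hj]
  calc ∑ W ∈ Wset, wt (univ.image W) * ∑ Ys : (∀ v, Fin (deg v) → Γ), (∏ u, ‖K u (Ys u)‖) *
          ‖kernel 𝕜 (((Script.treeFactor (pairLap 𝕜 C cl) s : laplacianAlgebra 𝕜 C cl) : Module.End 𝕜 (GrassmannAlgebra 𝕜 Γ))
            (genProd 𝕜 (flat Ys))) r W‖
      = ∑ W ∈ Wset, ∑ Ys : (∀ v, Fin (deg v) → Γ), wt (univ.image W) * ((∏ u, ‖K u (Ys u)‖) *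
          ‖kernel 𝕜 (((Script.treeFactor (pairLap 𝕜 C cl) s : laplacianAlgebra 𝕜 C cl) : Module.End 𝕜 (GrassmannAlgebra 𝕜 Γ))
            (genProd 𝕜 (flat Ys))) r W‖) := sum_congr rfl fun W _ => mul_sum _ _ _
    _ ≤ ∑ W ∈ Wset, ∑ Ys : (∀ v, Fin (deg v) → Γ),
          ∑ π ∈ P, (c₀ * κ ^ e * Iw) * ((∏ u, ‖K u (Ys u)‖) * (wt (univ.image W) * patWeight (flat Ys) (scriptOps C cl W s) π)) :=
        sum_le_sum fun W _ => sum_le_sum fun Ys _ => h1 W Ys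
    _ = (c₀ * κ ^ e * Iw) * ∑ π ∈ P, ∑ Ys : (∀ v, Fin (deg v) → Γ), (∏ u, ‖K u (Ys u)‖) *
          ∑ W ∈ Wset, wt (univ.image W) * patWeight (flat Ys) (scriptOps C cl W s) π := by
        rw [mul_sum]
        calc ∑ W ∈ Wset, ∑ Ys : (∀ v, Fin (deg v) → Γ),
                ∑ π ∈ P, (c₀ * κ ^ e * Iw) * ((∏ u, ‖K u (Ys u)‖) * (wt (univ.image W) * patWeight (flat Ys) (scriptOps C cl W s) π))
            = ∑ Ys : (∀ v, Fin (deg v) → Γ), ∑ W ∈ Wset,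
                ∑ π ∈ P, (c₀ * κ ^ e * Iw) * ((∏ u, ‖K u (Ys u)‖) * (wt (univ.image W) * patWeight (flat Ys) (scriptOps C cl W s) π)) :=
              sum_comm
          _ = ∑ Ys : (∀ v, Fin (deg v) → Γ), ∑ π ∈ P, ∑ W ∈ Wset,
                (c₀ * κ ^ e * Iw) * ((∏ u, ‖K u (Ys u)‖) * (wt (univ.image W) * patWeight (flat Ys) (scriptOps C cl W s) π)) :=
              sum_congr rfl fun Ys _ => sum_comm
          _ = ∑ π ∈ P, ∑ Ys : (∀ v, Fin (deg v) → Γ), ∑ W ∈ Wset,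
                (c₀ * κ ^ e * Iw) * ((∏ u, ‖K u (Ys u)‖) * (wt (univ.image W) * patWeight (flat Ys) (scriptOps C cl W s) π)) :=
              sum_comm
          _ = _ := sum_congr rfl fun π _ => by
              rw [mul_sum]
              refine sum_congr rfl fun Ys _ => ?_
              rw [mul_sum, mul_sum]
    _ ≤ (c₀ * κ ^ e * Iw) * ∑ π ∈ P, (if stepsOK preds π then 1 else 0) * ((c * (α / 2)) ^ k * Nφ (profOf π)) :=
        mul_le_mul_of_nonneg_left (sum_le_sum fun π hπ => hpat π hπ) (by positivity)
    _ = (c₀ * κ ^ e * Iw) * ((c * (α / 2)) ^ k * ∑ π ∈ P.filter (fun π => stepsOK preds π = true), Nφ (profOf π)) := by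
        congr 1
        rw [mul_sum, sum_filter]
        refine sum_congr rfl fun π _ => ?_
        split_ifs <;> ring
    _ = (c₀ * κ ^ e * Iw) * ((c * (α / 2)) ^ k * ∑ φ : J → Fin n,
          ∑ _π ∈ (P.filter fun π => stepsOK preds π = true).filter (fun π => profOf π = φ), Nφ φ) := by
        congr 2
        rw [← sum_fiberwise (P.filter fun π => stepsOK preds π = true) profOf fun π => Nφ (profOf π)]
        refine sum_congr rfl fun φ _ => sum_congr rfl fun π hπ => ?_
        rw [(mem_filter.1 hπ).2]
    _ ≤ (c₀ * κ ^ e * Iw) * ((c * (α / 2)) ^ k * ∑ φ : J → Fin n,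
          (M φ * (ext : ℝ) * (((s.lines.reverse.map fun ℓ => 2 * pairDeg deg ℓ).prod : ℕ) : ℝ)) * Nφ φ) := by
        refine mul_le_mul_of_nonneg_left (mul_le_mul_of_nonneg_left (sum_le_sum fun φ _ => ?_) (by positivity)) (by positivity)
        rw [sum_const, nsmul_eq_mul]
        exact mul_le_mul_of_nonneg_right (hcount φ) (hNφ0 φ)
    _ = ((c₀ * (ext : ℝ)) * κ ^ e * ∑ φ : J → Fin n, M φ * Nφ φ) *
          ((s.lines.map fun ℓ => (c * α) * (pairDeg deg ℓ : ℝ)).prod * Iw) := by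
        rw [hprod]
        have hsum : ∑ φ : J → Fin n, (M φ * (ext : ℝ) * (((s.lines.reverse.map fun ℓ => 2 * pairDeg deg ℓ).prod : ℕ) : ℝ)) * Nφ φ =
            ((ext : ℝ) * (((s.lines.reverse.map fun ℓ => 2 * pairDeg deg ℓ).prod : ℕ) : ℝ)) * ∑ φ : J → Fin n, M φ * Nφ φ := by
          rw [mul_sum]
          exact sum_congr rfl fun φ _ => by ring
        rw [hsum]
        ring

/-! ### The bound -/

/-- **The decay-weighted `L¹–L^∞` bound for the kernels of the truncated expectation of kernel vertices with prescribed output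
sectors and oriented tree lines** (Benfatto–Giuliani–Mastropietro 2006, (2.66)–(2.80) with §3 (3.2)–(3.8) and the sectorised
bookkeeping of §2.8 / App. A4 (A4.8)): as `sum_wt_norm_kernel_ursellOf_kernelVertex_le_prescribed`, with LEVELLED weighted anchored
norms (`hN` full pin / `hNsw` position-only pin, any legs sector-prescribed), a talking relation with at most `c` partners, and an
oracle `Nφ` bounding, for every covering anchored tree and landing profile `φ`, the product of the levelled norms for SOME reading of the
tree lines (`hNφ`):
`Σ_{W : W_i = w, A_j(W_j)} wt(W) ‖kernel_r 𝓔ᵀ_C(M_0,…,M_{n-1}) (W)‖ ≤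
  (r!)⁻¹ (∏_{j∉J}(N-j)) κ^{N - r - 2(n-1)} (Σ_{φ : J → vertices} (∏_{j∈J} m_{φ j}) Nφ φ) · λ^{-(n-1)} ∏_ℓ (1 + λ c α m m'_ℓ)`.
[cite: BenfattoGiulianiMastropietro2006, (2.66)-(2.80), §3 (3.2)-(3.8), §2.8 (2.97)-(2.98), App. A4 (A4.8)] -/
theorem sum_wt_norm_kernel_ursellOf_kernelVertex_le_oriented (hwt : IsTreeWeight wt) {κ : ℝ} (hκ : 0 ≤ κ) (hGB : IsGramBounded C κ)
    (hm : ∀ v, Even (deg v)) (hK : ∀ v Yv, K v Yv ≠ 0 → ∀ j, cl (Yv j) = v)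
    (sec : Γ → Sec) (ov : Sec → Sec → Prop) [DecidableRel ov] {c : ℕ} (hc1 : 1 ≤ c)
    (hov : ∀ σ' : Sec, (univ.filter fun σ : Sec => ov σ σ').card ≤ c)
    (hCov : ∀ ℓ X Y, typeRestrict C cl ℓ X Y ≠ 0 → ov (sec X) (sec Y) ∧ ov (sec Y) (sec X))
    {r : ℕ} (J : Finset (Fin r)) (A : Fin r → Γ → Bool) (σp : Fin r → Sec) (hA : ∀ j ∈ J, ∀ y, A j y = true → sec y = σp j)
    (Nv : Fin n → ℕ → ℝ) (hN0 : ∀ u F, 0 ≤ Nv u F)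
    (hN : ∀ (ρ' : Fin (∑ v, deg v) → Option Sec) (u : Fin n) (j : Fin (deg u)), ρ' (blockEmb deg u j) = none → ∀ a : Γ,
      ∑ Y ∈ univ.filter (fun Y : Fin (deg u) → Γ => Y j = a),
        (if ∀ j' σ, ρ' (blockEmb deg u j') = some σ → sec (Y j') = σ then ‖K u Y‖ * wt (univ.image Y) else 0) ≤
        Nv u (levR (vert deg) ρ' u + 1))
    (hNsw : ∀ (ρ' : Fin (∑ v, deg v) → Option Sec) (u : Fin n) (j : Fin (deg u)), ρ' (blockEmb deg u j) = none →
      ∃ g : Sec → ℝ, (∀ σ, 0 ≤ g σ) ∧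
      (∀ a : Γ, ∑ Y ∈ univ.filter (fun Y : Fin (deg u) → Γ => Y j = a),
        (if ∀ j' σ, ρ' (blockEmb deg u j') = some σ → sec (Y j') = σ then ‖K u Y‖ * wt (univ.image Y) else 0) ≤
          g (sec a)) ∧
      ∑ σ, g σ ≤ Nv u (levR (vert deg) ρ' u))
    (Nφ : (J → Fin n) → ℝ) (hNφ0 : ∀ φ, 0 ≤ Nφ φ)
    {α : ℝ} (hα : 0 ≤ α) (hrow : ∀ ℓ X, ∑ Y, ‖typeRestrict C cl ℓ X Y‖ * wt {X, Y} ≤ α)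
    (hcol : ∀ ℓ Y, ∑ X, ‖typeRestrict C cl ℓ X Y‖ * wt {X, Y} ≤ α)
    {lam : ℝ} (hlam : 0 < lam) (i : Fin r) (hi : i ∉ J) (w : Γ)
    (hNφ : ∀ {k : ℕ} (s : Script (cl w) k), s.Valid → univ.image s.y = univ → ∀ φ : J → Fin n, ∃ o : Fin n → Bool,
      ∏ u, Nv u ((univ.filter fun j : J => φ j = u).card + swChildren s o u + if u = cl w ∨ o u = true then 1 else 0) ≤ Nφ φ) :
    ∑ W ∈ univ.filter (fun W : Fin r → Γ => W i = w ∧ ∀ j ∈ J, A j (W j) = true), wt (univ.image W) *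
        ‖kernel 𝕜 ((ursellOf (convMoment 𝕜 C (kernelVertex 𝕜 hm K)) univ : evenPart 𝕜 Γ) : GrassmannAlgebra 𝕜 Γ) r W‖ ≤
      ((((r.factorial : ℝ))⁻¹ * ((∏ j ∈ univ.filter (fun j : Fin r => j ∉ J), ((∑ v, deg v) - (j : ℕ)) : ℕ) : ℝ)) *
          κ ^ ((∑ v, deg v) - (r + 2 * (n - 1))) *
          ∑ φ : J → Fin n, (∏ j, (deg (φ j) : ℝ)) * Nφ φ) *
        ((lam⁻¹) ^ (n - 1) * ∏ ℓ : Sym2 (Fin n), (1 + lam * ((c * α) * (pairDeg deg ℓ : ℝ)))) := by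
  have hn : 0 < n := Fin.pos (cl w)
  set a := (((r.factorial : ℝ))⁻¹ * ((∏ j ∈ univ.filter (fun j : Fin r => j ∉ J), ((∑ v, deg v) - (j : ℕ)) : ℕ) : ℝ)) with ha
  have ha0 : 0 ≤ a := mul_nonneg (inv_nonneg.2 (Nat.cast_nonneg _)) (Nat.cast_nonneg _)
  set SQ := ∑ φ : J → Fin n, (∏ j, (deg (φ j) : ℝ)) * Nφ φ with hSQ
  have hSQ0 : 0 ≤ SQ := sum_nonneg fun φ _ => mul_nonneg (prod_nonneg fun j _ => Nat.cast_nonneg _) (hNφ0 φ)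
  clear_value a SQ
  set y : Sym2 (Fin n) → ℝ := fun ℓ => (c * α) * (pairDeg deg ℓ : ℝ) with hy
  have hy0 : ∀ ℓ, 0 ≤ y ℓ := fun ℓ => mul_nonneg (mul_nonneg (Nat.cast_nonneg _) hα) (Nat.cast_nonneg _)
  set Wset := univ.filter (fun W : Fin r → Γ => W i = w ∧ ∀ j ∈ J, A j (W j) = true) with hWset
  -- abbreviation for the script terms
  set T : ∀ k : ℕ, Script (cl w) k → (Fin r → Γ) → (∀ v, Fin (deg v) → Γ) → ℝ := fun k s W Ys =>
    ‖kernel 𝕜 (((Script.treeFactor (pairLap 𝕜 C cl) s : laplacianAlgebra 𝕜 C cl) : Module.End 𝕜 (GrassmannAlgebra 𝕜 Γ))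
      (genProd 𝕜 (flat Ys))) r W‖ with hT
  calc ∑ W ∈ Wset, wt (univ.image W) * ‖kernel 𝕜 ((ursellOf (convMoment 𝕜 C (kernelVertex 𝕜 hm K)) univ : evenPart 𝕜 Γ) : GrassmannAlgebra 𝕜 Γ) r W‖
      ≤ ∑ W ∈ Wset, wt (univ.image W) * ∑ Ys : (∀ v, Fin (deg v) → Γ), (∏ u, ‖K u (Ys u)‖) * ∑ k ∈ range n, ∑ s : Script (cl w) k,
          if s.Valid ∧ univ.image s.y = univ then T k s W Ys else 0 :=
        sum_le_sum fun W _ => mul_le_mul_of_nonneg_left (norm_kernel_ursellOf_kernelVertex_le C cl K hm hK (cl w) r W) (hwt.nonneg _)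
    _ = ∑ k ∈ range n, ∑ s : Script (cl w) k, ∑ W ∈ Wset, wt (univ.image W) * ∑ Ys : (∀ v, Fin (deg v) → Γ),
          (∏ u, ‖K u (Ys u)‖) * (if s.Valid ∧ univ.image s.y = univ then T k s W Ys else 0) := by
        calc ∑ W ∈ Wset, wt (univ.image W) * ∑ Ys : (∀ v, Fin (deg v) → Γ), (∏ u, ‖K u (Ys u)‖) * ∑ k ∈ range n, ∑ s : Script (cl w) k,
                (if s.Valid ∧ univ.image s.y = univ then T k s W Ys else 0)
            = ∑ W ∈ Wset, ∑ k ∈ range n, ∑ s : Script (cl w) k, wt (univ.image W) * ∑ Ys : (∀ v, Fin (deg v) → Γ),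
                (∏ u, ‖K u (Ys u)‖) * (if s.Valid ∧ univ.image s.y = univ then T k s W Ys else 0) :=
              sum_congr rfl fun W _ => by
                calc wt (univ.image W) * ∑ Ys : (∀ v, Fin (deg v) → Γ), (∏ u, ‖K u (Ys u)‖) * ∑ k ∈ range n, ∑ s : Script (cl w) k,
                        (if s.Valid ∧ univ.image s.y = univ then T k s W Ys else 0)
                    = ∑ Ys : (∀ v, Fin (deg v) → Γ), ∑ k ∈ range n, ∑ s : Script (cl w) k,
                        wt (univ.image W) * ((∏ u, ‖K u (Ys u)‖) * (if s.Valid ∧ univ.image s.y = univ then T k s W Ys else 0)) := by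
                      rw [mul_sum]
                      exact sum_congr rfl fun Ys _ => by
                        rw [mul_sum, mul_sum]
                        exact sum_congr rfl fun k _ => by rw [mul_sum, mul_sum]
                  _ = ∑ k ∈ range n, ∑ Ys : (∀ v, Fin (deg v) → Γ), ∑ s : Script (cl w) k,
                        wt (univ.image W) * ((∏ u, ‖K u (Ys u)‖) * (if s.Valid ∧ univ.image s.y = univ then T k s W Ys else 0)) := sum_comm
                  _ = ∑ k ∈ range n, ∑ s : Script (cl w) k, ∑ Ys : (∀ v, Fin (deg v) → Γ),
                        wt (univ.image W) * ((∏ u, ‖K u (Ys u)‖) * (if s.Valid ∧ univ.image s.y = univ then T k s W Ys else 0)) :=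
                      sum_congr rfl fun k _ => sum_comm
                  _ = _ := sum_congr rfl fun k _ => sum_congr rfl fun s _ => by rw [mul_sum]
          _ = ∑ k ∈ range n, ∑ W ∈ Wset, ∑ s : Script (cl w) k, wt (univ.image W) * ∑ Ys : (∀ v, Fin (deg v) → Γ),
                (∏ u, ‖K u (Ys u)‖) * (if s.Valid ∧ univ.image s.y = univ then T k s W Ys else 0) := sum_comm
          _ = _ := sum_congr rfl fun k _ => sum_comm
    _ ≤ ∑ k ∈ range n, ∑ s : Script (cl w) k, (if s.Valid ∧ univ.image s.y = univ then
          (a * κ ^ ((∑ v, deg v) - (r + 2 * k)) * SQ) * ((s.lines.map y).prod * cubeIntegral (Fin n) ℝ (s.weight ℝ)) else 0) := by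
        refine sum_le_sum fun k _ => sum_le_sum fun s _ => ?_
        split_ifs with h
        · rw [ha, hSQ]
          have hmain := sum_wt_sum_norm_kernel_treeFactor_le_oriented C cl K hwt hκ hGB hK sec ov hc1 hov hCov J A σp hA Nv hN0
            hN hNsw Nφ hNφ0 hα hrow hcol s h.1 h.2 (hNφ s h.1 h.2) i hi
          calc ∑ W ∈ Wset, wt (univ.image W) * ∑ Ys : (∀ v, Fin (deg v) → Γ), (∏ u, ‖K u (Ys u)‖) * T k s W Ys
              = ∑ W ∈ Wset, wt (univ.image W) * ∑ Ys : (∀ v, Fin (deg v) → Γ), (∏ u, ‖K u (Ys u)‖) *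
                  ‖kernel 𝕜 (((Script.treeFactor (pairLap 𝕜 C cl) s : laplacianAlgebra 𝕜 C cl) :
                    Module.End 𝕜 (GrassmannAlgebra 𝕜 Γ)) (genProd 𝕜 (flat Ys))) r W‖ := rfl
            _ ≤ _ := hmain
        · simp
    _ = ∑ s : Script (cl w) (n - 1), (if s.Valid ∧ univ.image s.y = univ then
          (a * κ ^ ((∑ v, deg v) - (r + 2 * (n - 1))) * SQ) * ((s.lines.map y).prod * cubeIntegral (Fin n) ℝ (s.weight ℝ)) else 0) := by
        rw [sum_eq_single (n - 1)]
        · intro k _ hk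
          refine sum_eq_zero fun s _ => if_neg ?_
          rintro ⟨hs, hcov⟩
          have h := Script.card_image_y s hs
          rw [hcov, card_univ, Fintype.card_fin] at h
          omega
        · intro h
          exact absurd (mem_range.2 (by omega)) h
    _ ≤ (a * κ ^ ((∑ v, deg v) - (r + 2 * (n - 1))) * SQ) * ∑ s : Script (cl w) (n - 1),
          (if s.Valid then (s.lines.map y).prod * cubeIntegral (Fin n) ℝ (s.weight ℝ) else 0) := by
        rw [Finset.mul_sum]
        refine Finset.sum_le_sum fun s' _ => ?_
        have h0 := Script.prod_mul_weight_nonneg s' y hy0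
        by_cases hv : s'.Valid
        · by_cases hc : univ.image s'.y = univ
          · simp [hv, hc]
          · simp only [hv, hc, and_false, if_false, if_true]
            rw [if_pos hv] at h0
            exact mul_nonneg (mul_nonneg (mul_nonneg ha0 (pow_nonneg hκ _)) hSQ0) h0
        · simp [hv]
    _ ≤ (a * κ ^ ((∑ v, deg v) - (r + 2 * (n - 1))) * SQ) * ((lam⁻¹) ^ (n - 1) * ∏ ℓ : Sym2 (Fin n), (1 + lam * y ℓ)) :=
        mul_le_mul_of_nonneg_left (sum_prod_mul_weight_le_of_scale y hy0 (cl w) hlam (by rw [Fintype.card_fin]; omega))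
          (mul_nonneg (mul_nonneg ha0 (pow_nonneg hκ _)) hSQ0)

end Literature.MathematicalPhysics.QuantumLattice
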